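import Summits.ABC.IUTFork.Cor312PossibleImagesSlotM
import HarnessLib

/-!
# Branch C, M LINE — READ-U-M EXACT at every genuine datum over a rational point: the reading-(U) quantity `−|log(Θ)|` of abc-iut-s2-p8's
# `settingPrVolSharpM` with the datum's OWN Θ-ideles EQUALS Dupuy–Hilado's per-image non-archimedean number `T.I.negLogThetaPerImageNonarch`

PROOF-ONLY file (D-0012; no definitions, no `Prop` facts, no instances) of the abc-iut cell (branch C certificate seat abc-iut-C-cert-2 gen 5; row
«C:PU-IMAGES-COINCIDE», M-books corollary of `Cor312PossibleImagesSlotM` p490087). TAKES NO SIDE on [IUTchIII] Cor. 3.12 (kurims manuscript p. 173–174;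
Step (x) p. 181) or on the reading (U)/(P) of `−|log(Θ)|`; a statement about OUR typed objects.

At a genuine Θ-volume datum `T` over a point `P` with `Cor22.dmod P = 1` the fibres `V̲_u` are subsingletons (gen 4 `GenuineMSlot.fibre_subsingleton_of_dmod_eq_one`),
so the (U) and (P) possible-image families of the M books' setting COINCIDE (p490087 `GenuineMSlot.possibleImages_eq_thetaSlotImages_of_dmod_eq_one`) and gen 4's
READ-P-M theorem (`negLogThetaSlot_settingPrVolSharpM_eq_negLogThetaPerImageNonarch_of_isVolumeInputOf`, p469199) becomes a READ-U-M theorem: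

* **`GenuineMSlot.negLogTheta_eq_negLogThetaPerImageNonarch_of_dmod_eq_one`** — for the M books' setting (Θ-ideles `tOfIdeleData T.D (ideleDataOf T.D T.isVolumeInputOf)`,
  ANY q-ideles `tq`, `Sq`, context binders): `negLogTheta = ↑T.I.negLogThetaPerImageNonarch`, NO hypothesis beyond `d_mod = 1`.

CONTEXT: abc-iut-s2-p8's `negLogTheta_settingPrVolSharpM_tOfIdeleData_eq_negLogThetaNonarch_of_local_eq` (`Cor312ThetaSideExactAssemblyM`) gives the (U) closed form
`↑negLogThetaNonarch` CONDITIONAL on the per-packet equality binder (hA=); here, at `d_mod = 1`, the (U) value is obtained UNCONDITIONALLY through the (P) route.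
HONEST SCOPE: an identity between OUR typed objects at degree-one data; nothing about print's intended hull or the GLOBAL inequality; no side taken on any author;
typed ≠ proved (this: proved). [cite: Mochizuki2012, IUTchIII Cor. 3.12 p. 173–174, Step (x) p. 181; IUTchI Def. 3.1 (e) p. 62] [cite: DupuyHilado2025, §4.11–4.12]
[claim: Mochizuki2012, status: disputed] for every IUT sentence quoted.
-/

noncomputable section

open Set Function NumberField IsDedekindDomain

namespace Summit.ABC.IUTFork.Conditional

open Thm311 Thm311.Real Cor312 Cor312Vol Literature.IUT.LogThetaLattice Literature.IUT.LogVolume Literature.IUT.HodgeTheaters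
open Literature.NumberTheory.DiophantineGeometry.GenEll

/-- **READ-U-M EXACT at `d_mod = 1`**: at the M books' setting of `T`'s own Θ-ideles (ANY q-ideles / `Sq` / context binders) the reading-(U) number
`−|log(Θ)|` EQUALS `↑T.I.negLogThetaPerImageNonarch`. [cite: Mochizuki2012, IUTchIII Cor. 3.12 proof Step (x) p. 181] [cite: DupuyHilado2025, §4.12]
[claim: Mochizuki2012, status: disputed] -/
theorem GenuineMSlot.negLogTheta_eq_negLogThetaPerImageNonarch_of_dmod_eq_one {P : NFPoint} {l : ℕ} (T : Cor22.ThetaVolumeDatumAt P l)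
    (hd : Cor22.dmod P = 1)
    (M : Type) [Field M] [NumberField M]
    (archPk : letI := T.instFieldF; letI := T.instNumberFieldF; letI := T.instAlgebraF; letI := T.instFieldK;
        letI := T.instNumberFieldK; letI := T.instAlgebraK; letI := T.instFieldFbar; letI := T.instAlgebraFbar;
        letI := T.instAlgebraKFbar; letI := T.instIsElliptic;
      ∀ (j : (thetaIndexOfInitial T.D).Label) (vQ : (thetaIndexOfInitial T.D).VQ), Set ((logShellsOfInitialDH T.D (analyticLogvVal T.K)).Packet j vQ))
    (archSub : letI := T.instFieldF; letI := T.instNumberFieldF; letI := T.instAlgebraF; letI := T.instFieldK;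
        letI := T.instNumberFieldK; letI := T.instAlgebraK; letI := T.instFieldFbar; letI := T.instAlgebraFbar;
        letI := T.instAlgebraKFbar; letI := T.instIsElliptic;
      ∀ (j : (thetaIndexOfInitial T.D).Label) (v : (thetaIndexOfInitial T.D).V), Set ((logShellsOfInitialDH T.D (analyticLogvVal T.K)).Packet j ((thetaIndexOfInitial T.D).over v)))
    (Ψ : letI := T.instFieldF; letI := T.instNumberFieldF; letI := T.instAlgebraF; letI := T.instFieldK;
        letI := T.instNumberFieldK; letI := T.instAlgebraK; letI := T.instFieldFbar; letI := T.instAlgebraFbar;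
        letI := T.instAlgebraKFbar; letI := T.instIsElliptic;
      ℤ → ∀ v : (thetaIndexOfInitial T.D).V, v ∈ (thetaIndexOfInitial T.D).Vbad → Set ((logShellsOfInitialDH T.D (analyticLogvVal T.K)).StarPacket v))
    (act : letI := T.instFieldF; letI := T.instNumberFieldF; letI := T.instAlgebraF; letI := T.instFieldK;
        letI := T.instNumberFieldK; letI := T.instAlgebraK; letI := T.instFieldFbar; letI := T.instAlgebraFbar;
        letI := T.instAlgebraKFbar; letI := T.instIsElliptic;
      ℤ → ∀ v : (thetaIndexOfInitial T.D).V, v ∈ (thetaIndexOfInitial T.D).Vbad → (logShellsOfInitialDH T.D (analyticLogvVal T.K)).StarPacket v →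
        Module.End ℚ ((logShellsOfInitialDH T.D (analyticLogvVal T.K)).StarPacket v))
    (Mmod : letI := T.instFieldF; letI := T.instNumberFieldF; letI := T.instAlgebraF; letI := T.instFieldK;
        letI := T.instNumberFieldK; letI := T.instAlgebraK; letI := T.instFieldFbar; letI := T.instAlgebraFbar;
        letI := T.instAlgebraKFbar; letI := T.instIsElliptic;
      ℤ → ∀ j : (thetaIndexOfInitial T.D).LabelStar, Set ((logShellsOfInitialDH T.D (analyticLogvVal T.K)).GlobalPacket j.1))
    (region : letI := T.instFieldF; letI := T.instNumberFieldF; letI := T.instAlgebraF; letI := T.instFieldK;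
        letI := T.instNumberFieldK; letI := T.instAlgebraK; letI := T.instFieldFbar; letI := T.instAlgebraFbar;
        letI := T.instAlgebraKFbar; letI := T.instIsElliptic;
      ℤ → ∀ j : (thetaIndexOfInitial T.D).LabelStar, FinDivisor M → ∀ vQ : (thetaIndexOfInitial T.D).VQ,
        Set ((logShellsOfInitialDH T.D (analyticLogvVal T.K)).Packet j.1 vQ))
    (n : ℤ) {HT : Type} {LogLink : HT → HT → Type} {IsFull : ∀ {s t : HT}, LogLink s t → Prop}
    (lat : LGPGaussianLogThetaLattice LogLink IsFull)
    {Frd : Type} {IsoF : Frd → Frd → Type} {Ob : Frd → Type} {realify : Frd → Frd} {Strip : Type} {IsoS : Strip → Strip → Type}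
    {Mv : letI := T.instFieldF; letI := T.instNumberFieldF; letI := T.instAlgebraF; letI := T.instFieldK;
        letI := T.instNumberFieldK; letI := T.instAlgebraK; letI := T.instFieldFbar; letI := T.instAlgebraFbar;
        letI := T.instAlgebraKFbar; letI := T.instIsElliptic;
      ∀ v : (thetaIndexOfInitial T.D).V, v ∈ (thetaIndexOfInitial T.D).Vbad → Type}
    [∀ v h, Monoid (Mv v h)]
    (sig : letI := T.instFieldF; letI := T.instNumberFieldF; letI := T.instAlgebraF; letI := T.instFieldK;
        letI := T.instNumberFieldK; letI := T.instAlgebraK; letI := T.instFieldFbar; letI := T.instAlgebraFbar;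
        letI := T.instAlgebraKFbar; letI := T.instIsElliptic;
      GlobalLGPFrobenioidSignature (thetaIndexOfInitial T.D).lstar (thetaIndexOfInitial T.D).V (· ∈ (thetaIndexOfInitial T.D).Vbad) Frd IsoF Ob realify
        Strip IsoS Mv)
    (split : SplittingMonoids Mv) {ObΔ : Type}
    {N : letI := T.instFieldF; letI := T.instNumberFieldF; letI := T.instAlgebraF; letI := T.instFieldK;
        letI := T.instNumberFieldK; letI := T.instAlgebraK; letI := T.instFieldFbar; letI := T.instAlgebraFbar;
        letI := T.instAlgebraKFbar; letI := T.instIsElliptic;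
      ∀ v : (thetaIndexOfInitial T.D).V, v ∈ (thetaIndexOfInitial T.D).Vbad → Type}
    [∀ v h, Monoid (N v h)] (qData : QPilotData ObΔ N)
    (tq : letI := T.instFieldF; letI := T.instNumberFieldF; letI := T.instAlgebraF; letI := T.instFieldK;
        letI := T.instNumberFieldK; letI := T.instAlgebraK; letI := T.instFieldFbar; letI := T.instAlgebraFbar;
        letI := T.instAlgebraKFbar; letI := T.instIsElliptic; 
      ∀ (u : FinitePlace ℚ) (x : (thetaIndexOfInitial T.D).Fibre (Val.non u)), kOfM T.D (ratChar u) u (natCast_ratChar_mem u) x)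
    (htq0 : ∀ u x, tq u x ≠ 0) (Sq : Finset (FinitePlace ℚ))
    (htq1 : ∀ (u : FinitePlace ℚ) (x : letI := T.instFieldF; letI := T.instNumberFieldF; letI := T.instAlgebraF; letI := T.instFieldK;
        letI := T.instNumberFieldK; letI := T.instAlgebraK; letI := T.instFieldFbar; letI := T.instAlgebraFbar;
        letI := T.instAlgebraKFbar; letI := T.instIsElliptic; (thetaIndexOfInitial T.D).Fibre (Val.non u)), u ∉ Sq → ‖tq u x‖ = 1) :
    letI := T.instFieldF; letI := T.instNumberFieldF; letI := T.instAlgebraF; letI := T.instFieldK;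
        letI := T.instNumberFieldK; letI := T.instAlgebraK; letI := T.instFieldFbar; letI := T.instAlgebraFbar;
        letI := T.instAlgebraKFbar; letI := T.instIsElliptic; 
    (settingPrVolSharpM T.D (logvAnalyticVal_analyticLogvVal (K := T.K)) (tOfIdeleData T.D (ideleDataOf T.D T.isVolumeInputOf)) tq M archPk archSub Ψ
        act Mmod region n lat sig split qData htq0 Sq htq1).negLogTheta =
      ((T.I.negLogThetaPerImageNonarch : ℝ) : WithTop ℝ) := by
  letI := T.instFieldF; letI := T.instNumberFieldF; letI := T.instAlgebraF; letI := T.instFieldK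
  letI := T.instNumberFieldK; letI := T.instAlgebraK; letI := T.instFieldFbar; letI := T.instAlgebraFbar
  letI := T.instAlgebraKFbar; letI := T.instIsElliptic
  rw [congrArg ThetaVolumeInput.negLogThetaPerImageNonarch (eq_volumeInputOf_ideleDataOf T.D T.isVolumeInputOf)]
  exact negLogTheta_settingPrVolSharpM_tOfIdeleData_eq_negLogThetaPerImageNonarch_of_norm_const T.D (logvAnalyticVal_analyticLogvVal (K := T.K)) M
    archPk archSub Ψ act Mmod region n lat sig split qData tq htq0 Sq htq1 (ideleDataOf T.D T.isVolumeInputOf)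
    (fun u i x y => by rw [GenuineMSlot.fibre_subsingleton_of_dmod_eq_one T hd u x y])

end Summit.ABC.IUTFork.Conditional

end
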